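import Mathlib
import Summits.MatrixMultiplication.MatrixMultiplication.Theorems.GradedDesignFamily.Negative.SubfieldCellFootprint
import Summits.MatrixMultiplication.MatrixMultiplication.Theorems.GradedDesignFamily.Negative.SubfieldCellExpansion
import Summits.MatrixMultiplication.MatrixMultiplication.Theorems.GradedDesignFamily.Negative.SubfieldCellSlicedEndgame
import Summits.MatrixMultiplication.MatrixMultiplication.Theorems.GradedDesignFamily.Negative.SubfieldCellBorelEndgame
import Summits.MatrixMultiplication.MatrixMultiplication.Theorems.GradedDesignFamily.Negative.SubfieldCellStructure
import Summits.MatrixMultiplication.MatrixMultiplication.Theorems.GradedDesignFamily.Negative.SubfieldCellDetPigeonhole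
import Summits.MatrixMultiplication.MatrixMultiplication.Theorems.GradedDesignFamily.Negative.SubfieldCellSlicedCounting
import Summits.MatrixMultiplication.MatrixMultiplication.Theorems.GradedDesignFamily.Negative.SubfieldCellPropagation

/-!
# THEOREM F′ assembled: `¬S3` from three literature inputs
# (crux `LevelGradedCohnUmans.GradedDesignFamily`, stmt-MatrixMultiplication-7610; negative side,
# line `quadratic-extension-level-one-cell`, unit b2b-lgcu-subfield gen 18)

HONEST FRAMING.  The design stub S3 (`stub_subfieldCell` / `SubfieldCellFamily` of
`Cruxes/GradedDesignFamily/Lines/quadratic_extension_level_one_cell.lean`, restated verbatim below)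
is FALSE conditionally on three published theorems, each spelled out inline as a hypothesis in
Mathlib terms (no definitions):
* (T)  Tao 2008, Thm 4.6 — sets of small doubling `|A·B| ≤ K₀ √(|A||B|)` in any group are
  controlled by an `M(K₀)`-approximate subgroup [arXiv:math/0601431; cite item wi-56680];
* (BGT) Breuillard–Green–Tao 2011, Thm 1.3 for `SL₂` (embedded in `GL₂(K)` as `ker det`): a
  generating approximate subgroup of `SL₂(K)` is bounded or almost everything [arXiv:1005.1881;
  cite item wi-56684];
* (Dickson) a proper subgroup of `SL₂(K)` with `≥ β|K|²` elements fixes a line for `|K|` large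
  [Dickson's classification; cite item wi-56685].
Everything else is kernel-checked in this directory: the footprint reduction
(`not_subfieldCell_of_footprintExpansion`), the composition (`footprintExpansion_of_structure`), the
structure dichotomy from pieces (`structureDichotomy_of_pieces` with `subfieldCell_detPigeonhole`,
`subfieldCell_slicedCounting`, `subfieldCell_borelPropagation`), and the two endgames
(`subfieldCell_slicedEndgame`, `subfieldCell_borelEndgame`).  This decides the stub NEGATIVELY
(modulo the three inputs) and thereby retires the line `quadratic-extension-level-one-cell` as a road
to `GradedDesignFamily`; it is NOT summit progress.

Sorry-free. [folklore]
-/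

set_option linter.dupNamespace false

open scoped Pointwise

namespace Summit.MatrixMultiplication.MatrixMultiplication.Theorems.GradedDesignFamily.Negative

/-- **THEOREM F′ (assembled): (T) ∧ (BGT) ∧ (Dickson) ⟹ ¬S3.**  The conclusion is the negation of
`stub_subfieldCell`'s statement verbatim.  NOT summit progress. [folklore] -/
theorem not_subfieldCell_of_literature
    (hT : ∃ M : ℝ → ℝ, ∀ K₀ : ℝ, 1 ≤ K₀ → 1 ≤ M K₀ ∧
      ∀ (G : Type) [Group G] [DecidableEq G] (A B : Finset G), A.Nonempty → B.Nonempty →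
        ((A * B).card : ℝ) ≤ K₀ * Real.sqrt ((A.card : ℝ) * B.card) →
        ∃ H X : Finset G, IsApproximateSubgroup (M K₀) (H : Set G) ∧ (X.card : ℝ) ≤ M K₀ ∧
          (H.card : ℝ) ≤ M K₀ * Real.sqrt ((A.card : ℝ) * B.card) ∧ A ⊆ X * H ∧ B ⊆ H * X)
    (hBGT : ∃ C : ℝ → ℝ, ∀ K₀ : ℝ, 1 ≤ C K₀ ∧
      ∀ (K : Type) [Field K] [Fintype K] [DecidableEq K]
        (B : Finset (Matrix.GeneralLinearGroup (Fin 2) K)),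
        (∀ b ∈ B, Matrix.GeneralLinearGroup.det b = 1) →
        IsApproximateSubgroup K₀ (B : Set (Matrix.GeneralLinearGroup (Fin 2) K)) →
        Subgroup.closure (B : Set (Matrix.GeneralLinearGroup (Fin 2) K)) =
          (Matrix.GeneralLinearGroup.det : Matrix.GeneralLinearGroup (Fin 2) K →* Kˣ).ker →
        (B.card : ℝ) ≤ C K₀ ∨
          (Nat.card (Matrix.GeneralLinearGroup.det :
              Matrix.GeneralLinearGroup (Fin 2) K →* Kˣ).ker : ℝ) ≤ C K₀ * B.card)
    (hDickson : ∀ β : ℝ, 0 < β → ∃ Q₅ : ℕ, ∀ (K : Type) [Field K] [Fintype K] [DecidableEq K],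
      Q₅ ≤ Fintype.card K → ∀ L : Subgroup (Matrix.GeneralLinearGroup (Fin 2) K),
        L ≤ (Matrix.GeneralLinearGroup.det : Matrix.GeneralLinearGroup (Fin 2) K →* Kˣ).ker →
        L ≠ (Matrix.GeneralLinearGroup.det : Matrix.GeneralLinearGroup (Fin 2) K →* Kˣ).ker →
        (∃ B : Finset (Matrix.GeneralLinearGroup (Fin 2) K),
          (↑B : Set (Matrix.GeneralLinearGroup (Fin 2) K)) ⊆ L ∧
            β * (Fintype.card K : ℝ) ^ 2 ≤ B.card) →
        ∃ v : Fin 2 → K, v ≠ 0 ∧ ∀ g ∈ L, ∃ t : K,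
          (g : Matrix (Fin 2) (Fin 2) K).mulVec v = t • v) :
    ¬ (∃ c : ℝ, 0 < c ∧ ∀ N : ℕ, ∃ (k K : Type) (_ : Field k) (_ : Fintype k) (_ : DecidableEq k)
      (_ : Field K) (_ : Fintype K) (_ : DecidableEq K)
      (φ : Matrix.SpecialLinearGroup (Fin 2) k →* Matrix.GeneralLinearGroup (Fin 2) K),
      Function.Injective φ ∧ Fintype.card K = Fintype.card k ^ 2 ∧ N ≤ Fintype.card K ∧
      ∃ Y Z : Finset (Matrix.GeneralLinearGroup (Fin 2) K),
        c * (Fintype.card K : ℝ) ^ (3 / 2 : ℝ) ≤ (Finset.univ.image φ).card ∧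
        c * (Fintype.card K : ℝ) ^ (3 / 2 : ℝ) ≤ Y.card ∧
        c * (Fintype.card K : ℝ) ^ (3 / 2 : ℝ) ≤ Z.card ∧
        ∀ z₀ ∈ Z, ∃ cf : (Fin 2 → K) → (Fin 2 → K) → ℂ,
          ∀ a : Matrix.SpecialLinearGroup (Fin 2) k, ∀ y ∈ Y, ∀ y' ∈ Y, ∀ z ∈ Z,
            (∑ u : Fin 2 → K, cf u (((φ a * y * y'⁻¹ * z : Matrix.GeneralLinearGroup (Fin 2) K) :
                Matrix (Fin 2) (Fin 2) K).mulVec u)) =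
              if a = 1 ∧ y = y' ∧ z = z₀ then 1 else 0) :=
  not_subfieldCell_of_footprintExpansion
    (footprintExpansion_of_structure hT
      (structureDichotomy_of_pieces subfieldCell_detPigeonhole hBGT hDickson
        subfieldCell_slicedCounting subfieldCell_borelPropagation)
      subfieldCell_slicedEndgame subfieldCell_borelEndgame)

end Summit.MatrixMultiplication.MatrixMultiplication.Theorems.GradedDesignFamily.Negative
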